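import Literature.Computability.AlgebraicComplexity.BI17LatinAnnuliAlonTarsi
import HarnessLib

/-!
# The minimal degree `e(X_1⋯X_m)` of the Chow form for `2 ≤ m ≤ 24` (BI 2017 Prop. 3.25 / Rem. 3.26
# combined with the Alon–Tarsi theorems of the tree)

P. Bürgisser, C. Ikenmeyer, *Fundamental invariants of orbit closures*, J. Algebra **477** (2017)
390–434 = arXiv:1511.02927 [BurgisserIkenmeyer2017], §3.3: Prop. 3.25 ("Let `m` be even. Then
`e(X_1…X_m) ≥ m` and equality holds iff the Alon-Tarsi conjecture is true for `m`" — the tree's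
`BI2017_prop_3_25_holds`) and Rem. 3.26 (odd `m`: `e(X_1…X_m) = m+1` iff the `m × (m+1)` Latin
annulus count is nonzero — the tree's `BI2017_rem_3_26_holds`, sharpened in
`BI17LatinAnnuliAlonTarsi.lean` to "iff `AT(m+1)`"). Since the Alon–Tarsi conjecture is a THEOREM of
the tree for every even size `2 ≤ n ≤ 24` (`alonTarsi_of_even_le_24_holds`: Drisko `p + 1`, Glynn
`p − 1`), the minimal degree of `X_1⋯X_m` is known unconditionally for all `2 ≤ m ≤ 24`:
`e(X_1⋯X_m) = m` for even `m`, `= m + 1` for odd `m` (`minimalDegree_prod_X_eq_of_le`).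

Theorem-only; no definitions, no named facts. Honest framing: statements about the Chow form
`X_1⋯X_m`; nothing here bears on VP versus VNP.

## References

* [BurgisserIkenmeyer2017] P. Bürgisser, C. Ikenmeyer, J. Algebra 477 (2017), §3.3 Prop. 3.25,
  Rem. 3.26.
* [Drisko1997] A. A. Drisko, Adv. Math. 128 (1997), Thm. 9; [Glynn2010AlonTarsi] D. G. Glynn,
  SIAM J. Discrete Math. 24 (2010), Cor. 3.4 (the tree's `alonTarsi_of_even_le_24_holds`).
-/

open MvPolynomial

namespace Literature.Computability.AlgebraicComplexity

/-- **BI 2017 Prop. 3.25 in Alon–Tarsi language**: for even `m ≥ 2`, `e(X_1⋯X_m) = m ↔ AT(m)`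
(with the tree's `AlonTarsiConjecture`, via `latinColCount_ne_zero_iff`). [cite: BurgisserIkenmeyer2017, Prop. 3.25] -/
theorem minimalDegree_prod_X_eq_iff_alonTarsi {m : ℕ} (heven : Even m) (hm : 2 ≤ m) :
    minimalDegree m (∏ i : Fin m, X i : MvPolynomial (Fin m) ℂ) = m ↔
      Literature.Barriers.ValiantsHypothesis.AlonTarsiConjecture m := by
  rw [(BI2017_prop_3_25_holds m heven hm).2, Literature.Barriers.ValiantsHypothesis.latinColCount_ne_zero_iff]

/-- **`e(X_1⋯X_m) = m` unconditionally for even `2 ≤ m ≤ 24`** (Prop. 3.25 and the Alon–Tarsi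
theorems of the tree). [cite: BurgisserIkenmeyer2017, Prop. 3.25] -/
theorem minimalDegree_prod_X_eq_of_even_le {m : ℕ} (heven : Even m) (hm : 2 ≤ m) (h24 : m ≤ 24) :
    minimalDegree m (∏ i : Fin m, X i : MvPolynomial (Fin m) ℂ) = m :=
  (minimalDegree_prod_X_eq_iff_alonTarsi heven hm).mpr
    (Literature.Barriers.ValiantsHypothesis.alonTarsi_of_even_le_24_holds heven hm h24)

/-- **The minimal degree of the Chow form for `2 ≤ m ≤ 24`**: `e(X_1⋯X_m) = m` if `m` is even and
`= m + 1` if `m` is odd (BI 2017 Prop. 3.25 / Rem. 3.26 with `AT(n)` for even `n ≤ 24`).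
[cite: BurgisserIkenmeyer2017, Rem. 3.26] -/
theorem minimalDegree_prod_X_eq_of_le {m : ℕ} (hm : 2 ≤ m) (h24 : m ≤ 24) :
    minimalDegree m (∏ i : Fin m, X i : MvPolynomial (Fin m) ℂ) = if Even m then m else m + 1 := by
  split_ifs with h
  · exact minimalDegree_prod_X_eq_of_even_le h hm h24
  · have hodd : Odd m := Nat.not_even_iff_odd.mp h
    have h3 : 3 ≤ m ∧ m ≤ 23 := by
      obtain ⟨k, hk⟩ := hodd
      omega
    exact minimalDegree_prod_X_eq_succ_of_le hodd h3.1 h3.2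

end Literature.Computability.AlgebraicComplexity
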